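import Mathlib.Analysis.InnerProductSpace.PiL2
import Literature.Analysis.Matrix.ComponentwiseVerificationBounds
import HarnessLib

/-!
# Verified error bounds for (large, sparse) linear systems from a lower bound on the smallest singular value (Rump 1993, Theorems 2.1–2.3; Rump 1999, §4)

Topic `Analysis/Matrix`; namespace `Literature.Analysis.Matrix.SingularValueVerification`. Public
theorems (+ two private bridging lemmas to Mathlib's inner product), no `def`, no named fact, no
instance, no `sorry`, plus two `1 × 1` sanity examples.

SOURCES (both held and read; statements typed from the quoted places).

* S. M. Rump, *Validated Solution of Large Linear Systems*, in: R. Albrecht, G. Alefeld, H. J. Stetter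
  (eds.), *Validation Numerics*, Computing Supplementum 9, Springer (1993) 191–212
  [Rump1993] (held text `paper:doi-10-1007-978-3-7091-6918-6-15`, author's version, its pp. 10–14):
  - THEOREM 2.1 (p. 10–11, with (15)): if a floating-point Cholesky run on `LLᵀ − λ̃²I` returns a factor
    `G` with `‖(LLᵀ − λ̃²I) − GGᵀ‖_∞ ≤ ẽ_max`, then `LLᵀ − (λ̃² − ẽ_max)I` is positive semidefinite and, if
    `λ̃² ≥ ẽ_max`, `σ_n(L) ≥ (λ̃² − ẽ_max)^{1/2}`;
  - p. 12: `σ_n(Ã) = σ_n(L̃Ũ) ≥ σ_n(L̃)·σ_n(Ũ)`;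
  - THEOREM 2.2 (p. 11, (16)–(17)): `A, Ã ∈ ℝⁿˣⁿ`, `ΔA := Ã − A`, `σ_n(Ã) > n^{1/2}‖ΔA‖_∞` ⟹ `A` is not
    singular and `‖x̂ − x̃‖_∞ ≤ n^{1/2}‖b − Ax̃‖_∞ / (σ_n(Ã) − n^{1/2}‖ΔA‖_∞)` for `x̂ := A⁻¹b`; its proof's
    intermediate (17) `‖x̂ − x̃‖_∞ ≤ ‖Ã⁻¹(b − Ax̃)‖_∞ / (1 − ‖Ã⁻¹ΔA‖_∞)`;
  - THEOREM 2.3 (p. 13, (19)): `σ_n(Ã) > (‖ΔA‖₁‖ΔA‖_∞)^{1/2}` ⟹ `A` is not singular and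
    `‖x̂ − x̃‖_∞ ≤ ‖x̂ − x̃‖₂ ≤ ‖b − Ax̃‖₂ / (σ_n(Ã) − (‖ΔA‖₁‖ΔA‖_∞)^{1/2})`;
  - (21) (p. 14, `Ã = A` symmetric positive definite, the lower bound for `σ_n(A)` coming from the
    shifted Cholesky run applied to `A` itself).
* S. M. Rump, *Verified solution of large linear and nonlinear systems*, in: H. Bulgak, C. Zenger (eds.),
  *Error Control and Adaptivity in Scientific Computing*, Kluwer (1999) [Rump1999VerifiedLargeSystems]
  (held scan, PDF pp. 242–243), §4: (11) `‖x̃ − x̂‖ = ‖A⁻¹(Ax̃ − b)‖ ≤ σ_n(A)⁻¹‖Ax̃ − b‖`; for symmetric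
  `A`, a shift `s` and an approximate Cholesky factor `H` of `A − sI` with `Δ := A − sI − HHᵀ`:
  `σ_n(A) ≥ s − ‖Δ‖`; Algorithm 4.1 step 7: "If `s − δ > 0`" (`δ ≥ ‖Δ‖`) "then `A` is positive definite
  and `‖A⁻¹b − x̃‖ ≤ (s − δ)⁻¹‖Ax̃ − b‖`."

RENDERING. `‖v‖` of `v : n → ℝ` is the sup norm, `‖toLp 2 v‖` (Mathlib's `EuclideanSpace ℝ n`) the
Euclidean norm `‖v‖₂`; `‖M‖` of a matrix is Mathlib's `ℓ∞` OPERATOR NORM (max absolute row sum, scoped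
instance `Matrix.Norms.Operator`). A LOWER BOUND `s` FOR THE SMALLEST SINGULAR VALUE of `M` is rendered
by its defining property `∀ v, s‖v‖₂ ≤ ‖Mv‖₂` (this is `σ_n(M) ≥ s`; no singular value decomposition is
needed, and the theorems are monotone in `s`). `‖ΔA‖₁ ≤ c`, `‖ΔA‖_∞ ≤ r` are rendered by bounds on the
absolute column resp. row sums. Nonsingularity is `IsUnit A.det`. Rump assumes `Ã` nonsingular; in the
`σ_n(Ã) ≥ s > 0` rendering this is automatic and not a hypothesis.

WHAT IS PROVED.

* §0 (the `ℓ₂` toolkit the proofs quote from Golub–Van Loan [GolubVanLoan2013, §§2.2–2.3], Rump's [14]):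
  `‖v‖_∞ ≤ ‖v‖₂ ≤ n^{1/2}‖v‖_∞` (`pi_norm_le_norm_toLp`, `norm_toLp_le_sqrt_card_mul_pi_norm`),
  `|uᵀv| ≤ ‖u‖₂‖v‖₂`, `‖Bv‖₂ ≤ n^{1/2}‖B‖_∞‖v‖₂` (`norm_toLp_mulVec_le_sqrt_card`, i.e. `‖B‖₂ ≤ n^{1/2}‖B‖_∞`)
  and `‖Bv‖₂² ≤ ‖B‖₁‖B‖_∞‖v‖₂²` (`norm_toLp_mulVec_sq_le`, `norm_toLp_mulVec_le_sqrt`; the weighted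
  Cauchy–Schwarz proof, no spectral theory), `Σⱼ|Mᵢⱼ| ≤ ‖M‖_∞` (`rowSum_le_linfty_opNorm`).
* §1 (abstract core over any normed field and any size functional `N`): a lower bound survives a
  perturbation, `s N(v) ≤ N(Ãv)`, `N(ΔA v) ≤ d N(v)` ⟹ `(s − d) N(v) ≤ N(Av)` (`lower_bound_of_perturbation`);
  a positive lower bound makes `A` nonsingular (`isUnit_det_of_lower_bound`) and bounds the error of ANY
  approximate solution, `N(A⁻¹b − x̃) ≤ N(b − Ax̃)/t` (`size_inv_mulVec_sub_le_of_lower_bound`) — Rump 1999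
  (11); and (17) as the `R := Ã⁻¹` instance of Yamamoto's norm bound (`linfty_norm_sub_le_seventeen`).
* §2 (`ℓ₂` instances): `isUnit_det_of_sigma_lower`, `norm_toLp_inv_mulVec_sub_le` ((11)/(21) shape),
  the perturbed lower bounds `sigma_lower_of_linfty_perturbation` (`(s − n^{1/2}δ)‖v‖₂ ≤ ‖Av‖₂`) and
  `sigma_lower_of_one_linfty_perturbation` (`(s − (cr)^{1/2})‖v‖₂ ≤ ‖Av‖₂`), THEOREM 2.2 `rump_2_2`
  (conclusion (16), with the `ℓ₂` intermediate `rump_2_2_toLp`), THEOREM 2.3 `rump_2_3` ((19), both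
  inequalities), the product rule `sigma_lower_mul` (p. 12) and the assembled `Ã = L̃Ũ` form `rump_2_2_LU`.
* §3 (THEOREM 2.1 and the s.p.d. case): `abs_quadForm_le_of_transpose_eq` (`|vᵀEv| ≤ ‖E‖_∞‖v‖₂²` for
  symmetric `E` — the step "ρ(E) ≤ ‖E‖_∞" of p. 9), `quadForm_lower_of_shifted_residual`
  (`S` symmetric, `Σⱼ|(S − μI − GGᵀ)ᵢⱼ| ≤ e` ⟹ `(μ − e)‖v‖₂² ≤ vᵀSv`, i.e. `S − (μ − e)I ⪰ 0` as a
  quadratic-form inequality), `sq_sigma_lower_of_shifted_residual` (`S = LLᵀ`: `(μ − e)‖v‖₂² ≤ ‖Lᵀv‖₂²`),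
  the transfer `σ_n(Lᵀ) ≥ t > 0 ⟹ σ_n(L) ≥ t` for square `L` (`sigma_lower_of_transpose`, elementary
  duality proof), THEOREM 2.1 `rump_2_1` (`‖LLᵀ − μ•1 − GGᵀ‖_∞ ≤ e ≤ μ` ⟹ `√(μ − e)‖w‖₂ ≤ ‖Lw‖₂`), the
  symmetric case `sigma_lower_of_symm_shifted_residual` (Rump 1999 §4: `σ_n(A) ≥ s − ‖Δ‖`) and Algorithm
  4.1 step 7 / (21) `symm_solution_bound` (`e < μ` ⟹ `A` nonsingular and
  `‖A⁻¹b − x̃‖₂ ≤ ‖b − Ax̃‖₂/(μ − e)`).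

NOT TYPED (docstring honesty): the floating-point error recursion of Algorithm 2.1 (the quantities
`ΔS`, `ΔT`, `eᵢ` and directed rounding — a client supplies the certified residual bound `e`); positive
(semi)definiteness as a `Matrix.PosSemidef` statement and eigenvalue numbering (landed:
`Literature.Analysis.InnerProduct.CholeskyResidualEigenvalueBounds`,
`Literature.Computation.Certificates.DyadicCholResidualWitness`); Theorem 2.4 (interval data `[A]`,
`[b]`); the operation counts and band-structure remarks (§3); Rump 1999's inertia-based symmetric
indefinite variant and the augmented matrix `[0 Aᵀ; A 0]`; the exponent bookkeeping of (21) (we state the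
s.p.d. bound with the certified lower bound `μ − e` for `σ_n(A)` itself, as in Rump 1999 Algorithm 4.1).

## References

* S. M. Rump, *Validated Solution of Large Linear Systems*, Computing Suppl. 9 (1993) 191–212,
  doi:10.1007/978-3-7091-6918-6_15. [Rump1993]
* S. M. Rump, *Verified solution of large linear and nonlinear systems*, in Bulgak–Zenger (eds.), *Error
  Control and Adaptivity in Scientific Computing*, Kluwer (1999), §4, Algorithm 4.1. [Rump1999VerifiedLargeSystems]
* G. H. Golub, C. F. Van Loan, *Matrix Computations*, 4th ed. (2013) (held scan
  `book:golub2012-matrix-computations`, pp. 76, 79–80): §2.2.1 (2.2.1), §2.2.2 (2.2.3), (2.2.6), §2.3.2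
  (2.3.10), (2.3.11), §2.3.3 Corollary 2.3.2. [GolubVanLoan2013]
-/

open scoped Matrix.Norms.Operator
open Finset Matrix WithLp

namespace Literature.Analysis.Matrix.SingularValueVerification

/-! ### §0 The `ℓ₂` toolkit on `n → ℝ` -/

section L2

variable {n : Type*} [Fintype n]

/-- `‖v‖₂² = Σᵢ vᵢ²`. [cite: GolubVanLoan2013, §2.2.1 (2.2.1)] -/
theorem norm_toLp_sq (v : n → ℝ) : ‖toLp 2 v‖ ^ 2 = ∑ i, v i ^ 2 :=
  EuclideanSpace.real_norm_sq_eq _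

/-- `|vᵢ| ≤ ‖v‖₂`. [cite: GolubVanLoan2013, §2.2.2 (2.2.6)] -/
theorem abs_apply_le_norm_toLp (v : n → ℝ) (i : n) : |v i| ≤ ‖toLp 2 v‖ := by
  simpa using PiLp.norm_apply_le (toLp 2 v) i

/-- `‖v‖_∞ ≤ ‖v‖₂`. [cite: GolubVanLoan2013, §2.2.2 (2.2.6)] -/
theorem pi_norm_le_norm_toLp (v : n → ℝ) : ‖v‖ ≤ ‖toLp 2 v‖ :=
  (pi_norm_le_iff_of_nonneg (norm_nonneg _)).mpr fun i => by
    simpa using PiLp.norm_apply_le (toLp 2 v) i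

/-- `‖v‖₂ ≤ n^{1/2} ‖v‖_∞`. [cite: GolubVanLoan2013, §2.2.2 (2.2.6)] -/
theorem norm_toLp_le_sqrt_card_mul_pi_norm (v : n → ℝ) :
    ‖toLp 2 v‖ ≤ √(Fintype.card n) * ‖v‖ := by
  have h : ‖toLp 2 v‖ ^ 2 ≤ (√(Fintype.card n) * ‖v‖) ^ 2 := by
    rw [norm_toLp_sq, mul_pow, Real.sq_sqrt (Nat.cast_nonneg _)]
    calc ∑ i, v i ^ 2 ≤ ∑ _i : n, ‖v‖ ^ 2 := sum_le_sum fun i _ => by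
            rw [← sq_abs]
            exact pow_le_pow_left₀ (abs_nonneg _) (by simpa using norm_le_pi_norm v i) 2
      _ = (Fintype.card n : ℝ) * ‖v‖ ^ 2 := by rw [sum_const, card_univ, nsmul_eq_mul]
  exact (sq_le_sq₀ (norm_nonneg _) (by positivity)).mp h

/-- `uᵀv = ⟪u, v⟫` (bridge to Mathlib's inner product on `EuclideanSpace ℝ n`). [folklore] -/
private theorem dotProduct_eq_inner (u v : n → ℝ) : u ⬝ᵥ v = inner ℝ (toLp 2 u) (toLp 2 v) := by
  rw [EuclideanSpace.inner_toLp_toLp, star_trivial, dotProduct_comm]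

/-- `vᵀv = ‖v‖₂²`. [cite: GolubVanLoan2013, §2.2.1 (2.2.1)] -/
theorem dotProduct_self_eq_norm_toLp_sq (v : n → ℝ) : v ⬝ᵥ v = ‖toLp 2 v‖ ^ 2 := by
  rw [dotProduct_eq_inner, real_inner_self_eq_norm_sq]

/-- Cauchy–Schwarz: `|uᵀv| ≤ ‖u‖₂ ‖v‖₂`. [cite: GolubVanLoan2013, §2.2.2 (2.2.3)] -/
theorem abs_dotProduct_le (u v : n → ℝ) : |u ⬝ᵥ v| ≤ ‖toLp 2 u‖ * ‖toLp 2 v‖ := by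
  rw [dotProduct_eq_inner]
  exact abs_real_inner_le_norm _ _

/-- `‖Bv‖₂ ≤ n^{1/2} ‖B‖_∞ ‖v‖₂`, i.e. `‖B‖₂ ≤ n^{1/2}‖B‖_∞` (the norm comparison used in the proof of
Rump's Theorem 2.2). [cite: GolubVanLoan2013, §2.3.2 (2.3.11)] [cite: Rump1993, Theorem 2.2 (proof)] -/
theorem norm_toLp_mulVec_le_sqrt_card (B : Matrix n n ℝ) (v : n → ℝ) :
    ‖toLp 2 (B *ᵥ v)‖ ≤ √(Fintype.card n) * ‖B‖ * ‖toLp 2 v‖ :=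
  calc ‖toLp 2 (B *ᵥ v)‖ ≤ √(Fintype.card n) * ‖B *ᵥ v‖ := norm_toLp_le_sqrt_card_mul_pi_norm _
    _ ≤ √(Fintype.card n) * (‖B‖ * ‖v‖) :=
      mul_le_mul_of_nonneg_left (linfty_opNorm_mulVec B v) (Real.sqrt_nonneg _)
    _ ≤ √(Fintype.card n) * (‖B‖ * ‖toLp 2 v‖) :=
      mul_le_mul_of_nonneg_left (mul_le_mul_of_nonneg_left (pi_norm_le_norm_toLp v) (norm_nonneg _))
        (Real.sqrt_nonneg _)
    _ = √(Fintype.card n) * ‖B‖ * ‖toLp 2 v‖ := (mul_assoc _ _ _).symm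

/-- `‖Bv‖₂² ≤ ‖B‖₁ ‖B‖_∞ ‖v‖₂²` from bounds `c` on the absolute column sums and `r` on the absolute row
sums (weighted Cauchy–Schwarz: `(Σⱼ |bᵢⱼ||vⱼ|)² ≤ (Σⱼ |bᵢⱼ|)(Σⱼ |bᵢⱼ| vⱼ²)`), i.e.
`‖B‖₂ ≤ (‖B‖₁‖B‖_∞)^{1/2}`. [cite: GolubVanLoan2013, §2.3.3 Corollary 2.3.2] [cite: Rump1993, Theorem 2.3 (proof, p. 13)] -/
theorem norm_toLp_mulVec_sq_le (B : Matrix n n ℝ) (v : n → ℝ) {c r : ℝ}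
    (hc : ∀ j, ∑ i, |B i j| ≤ c) (hr : ∀ i, ∑ j, |B i j| ≤ r) :
    ‖toLp 2 (B *ᵥ v)‖ ^ 2 ≤ c * r * ‖toLp 2 v‖ ^ 2 := by
  rw [norm_toLp_sq, norm_toLp_sq]
  rcases isEmpty_or_nonempty n with hn | ⟨⟨i₀⟩⟩
  · simp
  have hr0 : 0 ≤ r := (sum_nonneg fun j _ => abs_nonneg _).trans (hr i₀)
  have hrow : ∀ i, (B *ᵥ v) i ^ 2 ≤ r * ∑ j, |B i j| * v j ^ 2 := fun i => by
    have h1 : |(B *ᵥ v) i| ≤ ∑ j, |B i j| * |v j| := by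
      simp only [mulVec, dotProduct]
      exact (abs_sum_le_sum_abs _ _).trans (le_of_eq (sum_congr rfl fun j _ => abs_mul _ _))
    have h2 : (∑ j, |B i j| * |v j|) ^ 2 ≤ (∑ j, |B i j|) * ∑ j, |B i j| * v j ^ 2 :=
      sum_sq_le_sum_mul_sum_of_sq_le_mul _ (fun j _ => abs_nonneg _)
        (fun j _ => mul_nonneg (abs_nonneg _) (sq_nonneg _))
        (fun j _ => le_of_eq (by rw [mul_pow, sq_abs (v j), sq]; ring))
    calc (B *ᵥ v) i ^ 2 = |(B *ᵥ v) i| ^ 2 := (sq_abs _).symm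
      _ ≤ (∑ j, |B i j| * |v j|) ^ 2 := pow_le_pow_left₀ (abs_nonneg _) h1 2
      _ ≤ (∑ j, |B i j|) * ∑ j, |B i j| * v j ^ 2 := h2
      _ ≤ r * ∑ j, |B i j| * v j ^ 2 :=
        mul_le_mul_of_nonneg_right (hr i) (sum_nonneg fun j _ => mul_nonneg (abs_nonneg _) (sq_nonneg _))
  calc ∑ i, (B *ᵥ v) i ^ 2 ≤ ∑ i, r * ∑ j, |B i j| * v j ^ 2 := sum_le_sum fun i _ => hrow i
    _ = r * ∑ j, (∑ i, |B i j|) * v j ^ 2 := by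
      rw [← mul_sum, sum_comm]
      exact congrArg _ (sum_congr rfl fun j _ => (sum_mul _ _ _).symm)
    _ ≤ r * ∑ j, c * v j ^ 2 := mul_le_mul_of_nonneg_left
        (sum_le_sum fun j _ => mul_le_mul_of_nonneg_right (hc j) (sq_nonneg _)) hr0
    _ = c * r * ∑ j, v j ^ 2 := by rw [← mul_sum]; ring

/-- `‖Bv‖₂ ≤ (‖B‖₁‖B‖_∞)^{1/2} ‖v‖₂` (square-root form of `norm_toLp_mulVec_sq_le`).
[cite: GolubVanLoan2013, §2.3.3 Corollary 2.3.2] [cite: Rump1993, Theorem 2.3 (proof, p. 13)] -/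
theorem norm_toLp_mulVec_le_sqrt (B : Matrix n n ℝ) (v : n → ℝ) {c r : ℝ}
    (hc : ∀ j, ∑ i, |B i j| ≤ c) (hr : ∀ i, ∑ j, |B i j| ≤ r) :
    ‖toLp 2 (B *ᵥ v)‖ ≤ √(c * r) * ‖toLp 2 v‖ :=
  calc ‖toLp 2 (B *ᵥ v)‖ = √(‖toLp 2 (B *ᵥ v)‖ ^ 2) := (Real.sqrt_sq (norm_nonneg _)).symm
    _ ≤ √(c * r * ‖toLp 2 v‖ ^ 2) := Real.sqrt_le_sqrt (norm_toLp_mulVec_sq_le B v hc hr)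
    _ = √(c * r) * ‖toLp 2 v‖ := by
      rw [Real.sqrt_mul' _ (sq_nonneg _), Real.sqrt_sq (norm_nonneg _)]

/-- Every absolute row sum is bounded by the `ℓ∞` operator norm: `Σⱼ |mᵢⱼ| ≤ ‖M‖_∞`.
[cite: GolubVanLoan2013, §2.3.2 (2.3.10)] -/
theorem rowSum_le_linfty_opNorm (M : Matrix n n ℝ) (i : n) : ∑ j, |M i j| ≤ ‖M‖ := by
  rw [linfty_opNorm_def]
  have h : (∑ j, ‖M i j‖₊) ≤ univ.sup fun i => ∑ j, ‖M i j‖₊ :=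
    Finset.le_sup (f := fun i => ∑ j, ‖M i j‖₊) (mem_univ i)
  have h' := NNReal.coe_le_coe.mpr h
  push_cast at h'
  simpa only [Real.norm_eq_abs] using h'

end L2

/-! ### §1 Abstract core: lower bounds, perturbation, nonsingularity, error of an approximate solution -/

section Abstract

variable {K : Type*} [NormedField K] {n : Type*} [Fintype n] [DecidableEq n]
  {A At : Matrix n n K} {N : (n → K) → ℝ} {s d t g : ℝ}

omit [DecidableEq n] in
/-- A lower bound survives a perturbation: if `s·N(v) ≤ N(Ãv)` and `N((Ã − A)v) ≤ d·N(v)` for all `v`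
(`N` subadditive), then `(s − d)·N(v) ≤ N(Av)` — the step `σ_n(A) ≥ σ_n(Ã) − ‖ΔA‖` behind Theorems
2.2/2.3. [cite: Rump1993, Theorem 2.2 (proof) and (2.3)–(2.5)] -/
theorem lower_bound_of_perturbation (hsub : ∀ v w, N (v + w) ≤ N v + N w)
    (hAt : ∀ v, s * N v ≤ N (At *ᵥ v)) (hΔ : ∀ v, N ((At - A) *ᵥ v) ≤ d * N v) (v : n → K) :
    (s - d) * N v ≤ N (A *ᵥ v) := by
  have h1 : At *ᵥ v = A *ᵥ v + (At - A) *ᵥ v := by rw [sub_mulVec]; abel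
  have h2 := hAt v
  rw [h1] at h2
  have h3 := h2.trans (hsub _ _)
  rw [sub_mul]
  linarith [hΔ v]

/-- A positive lower bound `t·N(v) ≤ N(Av)` for a size functional dominating the entries (`‖vᵢ‖ ≤ N v`,
`N 0 ≤ 0`) makes `A` nonsingular ("such a positive bound implies nonsingularity of `A`").
[cite: Rump1999VerifiedLargeSystems, §4 (before Algorithm 4.1)] [cite: Rump1993, Theorem 2.2] -/
theorem isUnit_det_of_lower_bound (hN : ∀ v i, ‖v i‖ ≤ N v) (hN0 : N 0 ≤ 0) (ht : 0 < t)
    (hA : ∀ v, t * N v ≤ N (A *ᵥ v)) : IsUnit A.det := by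
  rw [← isUnit_iff_isUnit_det, ← mulVec_injective_iff_isUnit]
  intro v w hvw
  have h0 : A *ᵥ (v - w) = 0 := by rw [mulVec_sub]; exact sub_eq_zero.mpr hvw
  have h1 : t * N (v - w) ≤ 0 := by
    have h := hA (v - w)
    rw [h0] at h
    exact h.trans hN0
  have h2 : N (v - w) ≤ 0 := not_lt.mp fun h => absurd h1 (not_le.mpr (mul_pos ht h))
  have h3 : v - w = 0 := funext fun i => by
    simpa using norm_le_zero_iff.mp ((hN (v - w) i).trans h2)
  exact sub_eq_zero.mp h3

/-- With a positive lower bound `t·N(v) ≤ N(Av)` and `A` nonsingular, ANY approximate solution `x̃`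
satisfies `N(A⁻¹b − x̃) ≤ N(b − Ax̃)/t` — (11): `‖x̃ − x̂‖ = ‖A⁻¹(Ax̃ − b)‖ ≤ σ_n(A)⁻¹‖Ax̃ − b‖`, "the results
may be formulated for other norms as well". [cite: Rump1999VerifiedLargeSystems, §4 (11)] [cite: Rump1993, (21)] -/
theorem size_inv_mulVec_sub_le_of_lower_bound (hA : IsUnit A.det) (ht : 0 < t)
    (hAv : ∀ v, t * N v ≤ N (A *ᵥ v)) (b xt : n → K) :
    N (A⁻¹ *ᵥ b - xt) ≤ N (b - A *ᵥ xt) / t := by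
  rw [le_div_iff₀ ht, mul_comm]
  have h := hAv (A⁻¹ *ᵥ b - xt)
  rwa [mulVec_sub, mulVec_mulVec, mul_nonsing_inv _ hA, one_mulVec] at h

/-- (17): for nonsingular `Ã` with `‖Ã⁻¹ΔA‖_∞ ≤ g < 1` (`ΔA := Ã − A`), `A` is nonsingular and
`‖x̂ − x̃‖_∞ ≤ ‖Ã⁻¹(b − Ax̃)‖_∞ / (1 − g)` — the `R := Ã⁻¹` instance of Yamamoto's norm bound
(`ComponentwiseVerification.linfty_norm_inv_mulVec_sub_le`, since `I − Ã⁻¹A = Ã⁻¹ΔA`).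
[cite: Rump1993, Theorem 2.2 (proof), (17)] -/
theorem linfty_norm_sub_le_seventeen (hAt : IsUnit At.det) (hg : ‖At⁻¹ * (At - A)‖ ≤ g) (hg1 : g < 1)
    (b xt : n → K) :
    IsUnit A.det ∧ ‖A⁻¹ *ᵥ b - xt‖ ≤ ‖At⁻¹ *ᵥ (b - A *ᵥ xt)‖ / (1 - g) := by
  have h1 : At⁻¹ * (At - A) = 1 - At⁻¹ * A := by rw [mul_sub, nonsing_inv_mul _ hAt]
  rw [h1] at hg
  exact ⟨(ComponentwiseVerification.isUnit_det_of_linfty_norm_lt hg hg1).1,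
    ComponentwiseVerification.linfty_norm_inv_mulVec_sub_le hg hg1 b xt⟩

end Abstract

/-! ### §2 The `ℓ₂` instances: Theorems 2.2 and 2.3 -/

section TwoNorm

variable {n : Type*} [Fintype n] [DecidableEq n] {A At : Matrix n n ℝ} {s δ : ℝ}

/-- `σ_n(A) ≥ s > 0` (`s‖v‖₂ ≤ ‖Av‖₂` for all `v`) ⟹ `A` nonsingular.
[cite: Rump1999VerifiedLargeSystems, §4] [cite: Rump1993, Theorem 2.2] -/
theorem isUnit_det_of_sigma_lower (hs : 0 < s) (hA : ∀ v, s * ‖toLp 2 v‖ ≤ ‖toLp 2 (A *ᵥ v)‖) :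
    IsUnit A.det :=
  isUnit_det_of_lower_bound (N := fun v => ‖toLp 2 v‖)
    (fun v i => by simpa using PiLp.norm_apply_le (toLp 2 v) i) (by simp) hs hA

/-- (11) / the shape of (21): `σ_n(A) ≥ s > 0` ⟹ `‖A⁻¹b − x̃‖₂ ≤ ‖b − Ax̃‖₂ / s` for every `x̃`.
[cite: Rump1999VerifiedLargeSystems, §4 (11)] [cite: Rump1993, (21)] -/
theorem norm_toLp_inv_mulVec_sub_le (hs : 0 < s) (hA : ∀ v, s * ‖toLp 2 v‖ ≤ ‖toLp 2 (A *ᵥ v)‖)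
    (b xt : n → ℝ) : ‖toLp 2 (A⁻¹ *ᵥ b - xt)‖ ≤ ‖toLp 2 (b - A *ᵥ xt)‖ / s :=
  size_inv_mulVec_sub_le_of_lower_bound (N := fun v => ‖toLp 2 v‖)
    (isUnit_det_of_sigma_lower hs hA) hs hA b xt

/-- The perturbed lower bound of Theorem 2.2: `σ_n(Ã) ≥ s`, `‖Ã − A‖_∞ ≤ δ` ⟹
`(s − n^{1/2}δ)‖v‖₂ ≤ ‖Av‖₂` for all `v`. [cite: Rump1993, Theorem 2.2 (proof) and (2.3)] -/
theorem sigma_lower_of_linfty_perturbation (hAt : ∀ v, s * ‖toLp 2 v‖ ≤ ‖toLp 2 (At *ᵥ v)‖)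
    (hΔ : ‖At - A‖ ≤ δ) (v : n → ℝ) :
    (s - √(Fintype.card n) * δ) * ‖toLp 2 v‖ ≤ ‖toLp 2 (A *ᵥ v)‖ :=
  lower_bound_of_perturbation (N := fun v => ‖toLp 2 v‖)
    (fun v w => by rw [toLp_add]; exact norm_add_le _ _) hAt
    (fun v => (norm_toLp_mulVec_le_sqrt_card _ v).trans
      (mul_le_mul_of_nonneg_right (mul_le_mul_of_nonneg_left hΔ (Real.sqrt_nonneg _))
        (norm_nonneg _))) v

/-- THEOREM 2.2, `ℓ₂` intermediate: `σ_n(Ã) ≥ s > n^{1/2}δ ≥ n^{1/2}‖Ã − A‖_∞` ⟹ `A` nonsingular and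
`‖A⁻¹b − x̃‖₂ ≤ ‖b − Ax̃‖₂ / (s − n^{1/2}δ)`. [cite: Rump1993, Theorem 2.2 (proof)] -/
theorem rump_2_2_toLp (hAt : ∀ v, s * ‖toLp 2 v‖ ≤ ‖toLp 2 (At *ᵥ v)‖) (hΔ : ‖At - A‖ ≤ δ)
    (hsδ : √(Fintype.card n) * δ < s) (b xt : n → ℝ) :
    IsUnit A.det ∧
      ‖toLp 2 (A⁻¹ *ᵥ b - xt)‖ ≤ ‖toLp 2 (b - A *ᵥ xt)‖ / (s - √(Fintype.card n) * δ) :=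
  have hlow := sigma_lower_of_linfty_perturbation hAt hΔ
  have hpos : 0 < s - √(Fintype.card n) * δ := sub_pos.mpr hsδ
  ⟨isUnit_det_of_sigma_lower hpos hlow, norm_toLp_inv_mulVec_sub_le hpos hlow b xt⟩

/-- **THEOREM 2.2** (16): let `A, Ã ∈ ℝⁿˣⁿ`, `σ_n(Ã) ≥ s`, `‖Ã − A‖_∞ ≤ δ` and `s > n^{1/2}δ`. Then `A`
is not singular and for `x̂ := A⁻¹b` and every `x̃`:
`‖x̂ − x̃‖_∞ ≤ n^{1/2}‖b − Ax̃‖_∞ / (s − n^{1/2}δ)`. [cite: Rump1993, Theorem 2.2 (16)] -/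
theorem rump_2_2 (hAt : ∀ v, s * ‖toLp 2 v‖ ≤ ‖toLp 2 (At *ᵥ v)‖) (hΔ : ‖At - A‖ ≤ δ)
    (hsδ : √(Fintype.card n) * δ < s) (b xt : n → ℝ) :
    IsUnit A.det ∧
      ‖A⁻¹ *ᵥ b - xt‖ ≤ √(Fintype.card n) * ‖b - A *ᵥ xt‖ / (s - √(Fintype.card n) * δ) := by
  obtain ⟨hA, h2⟩ := rump_2_2_toLp hAt hΔ hsδ b xt
  refine ⟨hA, ?_⟩
  calc ‖A⁻¹ *ᵥ b - xt‖ ≤ ‖toLp 2 (A⁻¹ *ᵥ b - xt)‖ := pi_norm_le_norm_toLp _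
    _ ≤ ‖toLp 2 (b - A *ᵥ xt)‖ / (s - √(Fintype.card n) * δ) := h2
    _ ≤ √(Fintype.card n) * ‖b - A *ᵥ xt‖ / (s - √(Fintype.card n) * δ) :=
      div_le_div_of_nonneg_right (norm_toLp_le_sqrt_card_mul_pi_norm _) (sub_pos.mpr hsδ).le

omit [DecidableEq n] in
/-- The perturbed lower bound of Theorem 2.3: `σ_n(Ã) ≥ s`, absolute column sums of `Ã − A` at most `c`
and absolute row sums at most `r` ⟹ `(s − (cr)^{1/2})‖v‖₂ ≤ ‖Av‖₂` for all `v`.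
[cite: Rump1993, Theorem 2.3 (proof) and (2.4)] -/
theorem sigma_lower_of_one_linfty_perturbation (hAt : ∀ v, s * ‖toLp 2 v‖ ≤ ‖toLp 2 (At *ᵥ v)‖)
    {c r : ℝ} (hc : ∀ j, ∑ i, |(At - A) i j| ≤ c) (hr : ∀ i, ∑ j, |(At - A) i j| ≤ r) (v : n → ℝ) :
    (s - √(c * r)) * ‖toLp 2 v‖ ≤ ‖toLp 2 (A *ᵥ v)‖ :=
  lower_bound_of_perturbation (N := fun v => ‖toLp 2 v‖)
    (fun v w => by rw [toLp_add]; exact norm_add_le _ _) hAt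
    (fun v => norm_toLp_mulVec_le_sqrt _ v hc hr) v

/-- **THEOREM 2.3** (19): let `σ_n(Ã) ≥ s`, `‖Ã − A‖₁ ≤ c`, `‖Ã − A‖_∞ ≤ r` (absolute column / row sums)
and `s > (cr)^{1/2}`. Then `A` is not singular and for `x̂ := A⁻¹b` and every `x̃`:
`‖x̂ − x̃‖_∞ ≤ ‖x̂ − x̃‖₂ ≤ ‖b − Ax̃‖₂ / (s − (cr)^{1/2})`. [cite: Rump1993, Theorem 2.3 (19)] -/
theorem rump_2_3 (hAt : ∀ v, s * ‖toLp 2 v‖ ≤ ‖toLp 2 (At *ᵥ v)‖) {c r : ℝ}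
    (hc : ∀ j, ∑ i, |(At - A) i j| ≤ c) (hr : ∀ i, ∑ j, |(At - A) i j| ≤ r) (hcr : √(c * r) < s)
    (b xt : n → ℝ) :
    IsUnit A.det ∧ ‖A⁻¹ *ᵥ b - xt‖ ≤ ‖toLp 2 (A⁻¹ *ᵥ b - xt)‖ ∧
      ‖toLp 2 (A⁻¹ *ᵥ b - xt)‖ ≤ ‖toLp 2 (b - A *ᵥ xt)‖ / (s - √(c * r)) :=
  have hlow := sigma_lower_of_one_linfty_perturbation hAt hc hr
  have hpos : 0 < s - √(c * r) := sub_pos.mpr hcr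
  ⟨isUnit_det_of_sigma_lower hpos hlow, pi_norm_le_norm_toLp _,
    norm_toLp_inv_mulVec_sub_le hpos hlow b xt⟩

omit [DecidableEq n] in
/-- `σ_n(L̃Ũ) ≥ σ_n(L̃)·σ_n(Ũ)`: lower bounds multiply (`s_L ≥ 0`). [cite: Rump1993, p. 12 (application of Theorem 2.1)] -/
theorem sigma_lower_mul {L U : Matrix n n ℝ} {sL sU : ℝ} (hsL : 0 ≤ sL)
    (hL : ∀ v, sL * ‖toLp 2 v‖ ≤ ‖toLp 2 (L *ᵥ v)‖) (hU : ∀ v, sU * ‖toLp 2 v‖ ≤ ‖toLp 2 (U *ᵥ v)‖)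
    (v : n → ℝ) : sL * sU * ‖toLp 2 v‖ ≤ ‖toLp 2 ((L * U) *ᵥ v)‖ := by
  rw [← mulVec_mulVec, mul_assoc]
  exact (mul_le_mul_of_nonneg_left (hU v) hsL).trans (hL _)

/-- THEOREM 2.2 for a factored approximation `Ã = L̃Ũ` ("in a practical application `Ã` is some
floating-point decomposition of `A`"): `σ_n(L̃) ≥ s_L ≥ 0`, `σ_n(Ũ) ≥ s_U`, `‖L̃Ũ − A‖_∞ ≤ δ`,
`s_L s_U > n^{1/2}δ` ⟹ `A` nonsingular and `‖A⁻¹b − x̃‖_∞ ≤ n^{1/2}‖b − Ax̃‖_∞/(s_L s_U − n^{1/2}δ)`.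
[cite: Rump1993, Theorem 2.2 with p. 11–12] -/
theorem rump_2_2_LU {L U : Matrix n n ℝ} {sL sU : ℝ} (hsL : 0 ≤ sL)
    (hL : ∀ v, sL * ‖toLp 2 v‖ ≤ ‖toLp 2 (L *ᵥ v)‖) (hU : ∀ v, sU * ‖toLp 2 v‖ ≤ ‖toLp 2 (U *ᵥ v)‖)
    (hΔ : ‖L * U - A‖ ≤ δ) (hsδ : √(Fintype.card n) * δ < sL * sU) (b xt : n → ℝ) :
    IsUnit A.det ∧
      ‖A⁻¹ *ᵥ b - xt‖ ≤ √(Fintype.card n) * ‖b - A *ᵥ xt‖ / (sL * sU - √(Fintype.card n) * δ) :=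
  rump_2_2 (sigma_lower_mul hsL hL hU) hΔ hsδ b xt

end TwoNorm

/-! ### §3 Theorem 2.1: a lower bound for `σ_n(L)` from a shifted Cholesky residual; the symmetric case -/

section ShiftedCholesky

variable {n k : Type*} [Fintype n] [Fintype k] [DecidableEq n]

omit [DecidableEq n] in
/-- For SYMMETRIC `E` with absolute row sums `≤ e`: `|vᵀEv| ≤ e‖v‖₂²` (the step `ρ(E) ≤ ‖E‖_∞`; here
via `‖E‖₂ ≤ (‖E‖₁‖E‖_∞)^{1/2} = ‖E‖_∞` and Cauchy–Schwarz). [cite: Rump1993, §2 p. 9–10 (before Theorem 2.1)] -/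
theorem abs_quadForm_le_of_transpose_eq {E : Matrix n n ℝ} (hE : Eᵀ = E) {e : ℝ}
    (hr : ∀ i, ∑ j, |E i j| ≤ e) (v : n → ℝ) : |v ⬝ᵥ (E *ᵥ v)| ≤ e * ‖toLp 2 v‖ ^ 2 := by
  rcases isEmpty_or_nonempty n with hn | ⟨⟨i₀⟩⟩
  · simp [dotProduct, norm_toLp_sq]
  have he : 0 ≤ e := (sum_nonneg fun j _ => abs_nonneg _).trans (hr i₀)
  have hc : ∀ j, ∑ i, |E i j| ≤ e := fun j =>
    calc ∑ i, |E i j| = ∑ i, |Eᵀ j i| := rfl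
      _ = ∑ i, |E j i| := by rw [hE]
      _ ≤ e := hr j
  calc |v ⬝ᵥ (E *ᵥ v)| ≤ ‖toLp 2 v‖ * ‖toLp 2 (E *ᵥ v)‖ := abs_dotProduct_le _ _
    _ ≤ ‖toLp 2 v‖ * (√(e * e) * ‖toLp 2 v‖) :=
      mul_le_mul_of_nonneg_left (norm_toLp_mulVec_le_sqrt E v hc hr) (norm_nonneg _)
    _ = e * ‖toLp 2 v‖ ^ 2 := by rw [Real.sqrt_mul_self he]; ring

omit [DecidableEq n] in
/-- `vᵀ(MMᵀ)v = ‖Mᵀv‖₂²`. [folklore] -/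
private theorem dotProduct_mul_transpose_mulVec (M : Matrix n k ℝ) (v : n → ℝ) :
    v ⬝ᵥ ((M * Mᵀ) *ᵥ v) = ‖toLp 2 (Mᵀ *ᵥ v)‖ ^ 2 := by
  rw [← mulVec_mulVec, dotProduct_mulVec v M, ← mulVec_transpose, dotProduct_self_eq_norm_toLp_sq]

/-- The kernel of Theorem 2.1 as a quadratic-form inequality: `S` symmetric, `G` any real factor, and the
residual `E := S − μI − GGᵀ` has absolute row sums `≤ e` ⟹ `(μ − e)‖v‖₂² ≤ vᵀSv` for all `v`
(`S − (μ − e)I` is positive semidefinite; `vᵀSv = vᵀEv + μ‖v‖₂² + ‖Gᵀv‖₂² ≥ (μ − e)‖v‖₂²`).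
[cite: Rump1993, Theorem 2.1 with (15)] [cite: Rump1999VerifiedLargeSystems, §4 (σ_n(A) ≥ s − ‖Δ‖)] -/
theorem quadForm_lower_of_shifted_residual {S : Matrix n n ℝ} (hS : Sᵀ = S) (G : Matrix n k ℝ)
    {μ e : ℝ} (hE : ∀ i, ∑ j, |(S - μ • (1 : Matrix n n ℝ) - G * Gᵀ) i j| ≤ e) (v : n → ℝ) :
    (μ - e) * ‖toLp 2 v‖ ^ 2 ≤ v ⬝ᵥ (S *ᵥ v) := by
  set E := S - μ • (1 : Matrix n n ℝ) - G * Gᵀ with hEdef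
  have hEt : Eᵀ = E := by
    rw [hEdef, transpose_sub, transpose_sub, transpose_mul, transpose_transpose, transpose_smul,
      transpose_one, hS]
  have hmat : S = E + μ • (1 : Matrix n n ℝ) + G * Gᵀ := by rw [hEdef]; abel
  have h1 : v ⬝ᵥ ((μ • (1 : Matrix n n ℝ)) *ᵥ v) = μ * ‖toLp 2 v‖ ^ 2 := by
    rw [smul_mulVec, one_mulVec, dotProduct_smul, smul_eq_mul, dotProduct_self_eq_norm_toLp_sq]
  have hsum : v ⬝ᵥ (S *ᵥ v) = v ⬝ᵥ (E *ᵥ v) + μ * ‖toLp 2 v‖ ^ 2 + ‖toLp 2 (Gᵀ *ᵥ v)‖ ^ 2 := by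
    conv_lhs => rw [hmat]
    rw [add_mulVec, add_mulVec, dotProduct_add, dotProduct_add, h1, dotProduct_mul_transpose_mulVec]
  have hEv : -(e * ‖toLp 2 v‖ ^ 2) ≤ v ⬝ᵥ (E *ᵥ v) :=
    (abs_le.mp (abs_quadForm_le_of_transpose_eq hEt hE v)).1
  rw [hsum]
  nlinarith [sq_nonneg ‖toLp 2 (Gᵀ *ᵥ v)‖, hEv]

/-- THEOREM 2.1, squared form: if the residual of a (floating-point) Cholesky run on `LLᵀ − μI` satisfies
`Σⱼ |(LLᵀ − μI − GGᵀ)ᵢⱼ| ≤ e` for every row, then `(μ − e)‖v‖₂² ≤ ‖Lᵀv‖₂²` for all `v`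
(`LLᵀ − (μ − e)I ⪰ 0`; with `μ = λ̃²`, `e = ẽ_max`). [cite: Rump1993, Theorem 2.1 with (15)] -/
theorem sq_sigma_lower_of_shifted_residual (L : Matrix n n ℝ) (G : Matrix n k ℝ) {μ e : ℝ}
    (hE : ∀ i, ∑ j, |(L * Lᵀ - μ • (1 : Matrix n n ℝ) - G * Gᵀ) i j| ≤ e) (v : n → ℝ) :
    (μ - e) * ‖toLp 2 v‖ ^ 2 ≤ ‖toLp 2 (Lᵀ *ᵥ v)‖ ^ 2 := by
  rw [← dotProduct_mul_transpose_mulVec]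
  have hS : (L * Lᵀ)ᵀ = L * Lᵀ := by rw [transpose_mul, transpose_transpose]
  exact quadForm_lower_of_shifted_residual hS G hE v

/-- For a square matrix the smallest singular values of `L` and `Lᵀ` agree, in lower-bound form:
`t > 0`, `t‖v‖₂ ≤ ‖Lᵀv‖₂` for all `v` ⟹ `t‖w‖₂ ≤ ‖Lw‖₂` for all `w` (elementary: `P := (Lᵀ)⁻¹` has
`t‖Pu‖₂ ≤ ‖u‖₂`, and `‖Pᵀu‖₂² = uᵀP(Pᵀu) ≤ ‖u‖₂‖Pᵀu‖₂/t` transfers the bound to `Pᵀ = L⁻¹`).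
[folklore] [cite: Rump1993, Theorem 2.1 ("the eigenvalues of LLᵀ are the squared singular values of L")] -/
theorem sigma_lower_of_transpose {L : Matrix n n ℝ} {t : ℝ} (ht : 0 < t)
    (h : ∀ v, t * ‖toLp 2 v‖ ≤ ‖toLp 2 (Lᵀ *ᵥ v)‖) (w : n → ℝ) :
    t * ‖toLp 2 w‖ ≤ ‖toLp 2 (L *ᵥ w)‖ := by
  have hLT : IsUnit Lᵀ.det := isUnit_det_of_sigma_lower ht h
  have hL : IsUnit L.det := by rwa [det_transpose] at hLT
  -- `P := (Lᵀ)⁻¹` satisfies `t ‖P u‖₂ ≤ ‖u‖₂`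
  have hP : ∀ u, t * ‖toLp 2 (Lᵀ⁻¹ *ᵥ u)‖ ≤ ‖toLp 2 u‖ := fun u => by
    have h' := h (Lᵀ⁻¹ *ᵥ u)
    rwa [mulVec_mulVec, mul_nonsing_inv _ hLT, one_mulVec] at h'
  -- and so does `Pᵀ = L⁻¹`
  have h1 : (Lᵀ⁻¹)ᵀ = L⁻¹ := by rw [transpose_nonsing_inv, transpose_transpose]
  have hPT : ∀ u, t * ‖toLp 2 (L⁻¹ *ᵥ u)‖ ≤ ‖toLp 2 u‖ := fun u => by
    have h2 : (L⁻¹ *ᵥ u) ⬝ᵥ (L⁻¹ *ᵥ u) = u ⬝ᵥ (Lᵀ⁻¹ *ᵥ (L⁻¹ *ᵥ u)) := by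
      rw [dotProduct_mulVec u (Lᵀ⁻¹) (L⁻¹ *ᵥ u), ← mulVec_transpose, h1]
    have h3 : ‖toLp 2 (L⁻¹ *ᵥ u)‖ ^ 2 ≤ ‖toLp 2 u‖ * (‖toLp 2 (L⁻¹ *ᵥ u)‖ / t) := by
      rw [← dotProduct_self_eq_norm_toLp_sq, h2]
      refine (le_abs_self _).trans ((abs_dotProduct_le _ _).trans ?_)
      refine mul_le_mul_of_nonneg_left ?_ (norm_nonneg _)
      rw [le_div_iff₀ ht, mul_comm]
      exact hP _
    rcases (norm_nonneg (toLp 2 (L⁻¹ *ᵥ u))).eq_or_lt with hy | hy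
    · rw [← hy, mul_zero]; exact norm_nonneg _
    · have h5 : t * ‖toLp 2 (L⁻¹ *ᵥ u)‖ * ‖toLp 2 (L⁻¹ *ᵥ u)‖ ≤
          ‖toLp 2 u‖ * ‖toLp 2 (L⁻¹ *ᵥ u)‖ :=
        calc t * ‖toLp 2 (L⁻¹ *ᵥ u)‖ * ‖toLp 2 (L⁻¹ *ᵥ u)‖ = t * ‖toLp 2 (L⁻¹ *ᵥ u)‖ ^ 2 := by ring
          _ ≤ t * (‖toLp 2 u‖ * (‖toLp 2 (L⁻¹ *ᵥ u)‖ / t)) := mul_le_mul_of_nonneg_left h3 ht.le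
          _ = ‖toLp 2 u‖ * ‖toLp 2 (L⁻¹ *ᵥ u)‖ := by field_simp
      exact le_of_mul_le_mul_right h5 hy
  have hw : L⁻¹ *ᵥ (L *ᵥ w) = w := by rw [mulVec_mulVec, nonsing_inv_mul _ hL, one_mulVec]
  have h6 := hPT (L *ᵥ w)
  rwa [hw] at h6

/-- **THEOREM 2.1** (with (15)): if the residual of a floating-point Cholesky factorisation
`GGᵀ ≈ LLᵀ − λ̃²I` satisfies `‖(LLᵀ − λ̃²I) − GGᵀ‖_∞ ≤ ẽ_max ≤ λ̃²` then
`σ_n(L) ≥ (λ̃² − ẽ_max)^{1/2}`: with `μ = λ̃²`, `e = ẽ_max`, `√(μ − e)‖w‖₂ ≤ ‖Lw‖₂` for all `w`. No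
accuracy of `G` is presumed ("`G` is computed in floating-point arithmetic without presumptions on its
accuracy"). [cite: Rump1993, Theorem 2.1] -/
theorem rump_2_1 (L : Matrix n n ℝ) (G : Matrix n k ℝ) {μ e : ℝ}
    (hE : ‖L * Lᵀ - μ • (1 : Matrix n n ℝ) - G * Gᵀ‖ ≤ e) (hμ : e ≤ μ) (w : n → ℝ) :
    √(μ - e) * ‖toLp 2 w‖ ≤ ‖toLp 2 (L *ᵥ w)‖ := by
  have hrow : ∀ i, ∑ j, |(L * Lᵀ - μ • (1 : Matrix n n ℝ) - G * Gᵀ) i j| ≤ e :=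
    fun i => (rowSum_le_linfty_opNorm _ i).trans hE
  have hT : ∀ v, √(μ - e) * ‖toLp 2 v‖ ≤ ‖toLp 2 (Lᵀ *ᵥ v)‖ := fun v => by
    have h2 : (√(μ - e) * ‖toLp 2 v‖) ^ 2 ≤ ‖toLp 2 (Lᵀ *ᵥ v)‖ ^ 2 := by
      rw [mul_pow, Real.sq_sqrt (sub_nonneg.mpr hμ)]
      exact sq_sigma_lower_of_shifted_residual L G hrow v
    exact (sq_le_sq₀ (by positivity) (norm_nonneg _)).mp h2
  rcases hμ.eq_or_lt with h0 | hlt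
  · rw [h0, sub_self, Real.sqrt_zero, zero_mul]; exact norm_nonneg _
  · exact sigma_lower_of_transpose (Real.sqrt_pos.mpr (sub_pos.mpr hlt)) hT w

/-- The symmetric case (Rump 1999 §4; (21)): `A` symmetric, `G` an approximate Cholesky factor of
`A − μI` with `‖A − μI − GGᵀ‖_∞ ≤ e` ⟹ `σ_n(A) ≥ μ − e`, i.e. `(μ − e)‖v‖₂ ≤ ‖Av‖₂` for all `v`
("`σ_n(A) ≥ s − ‖Δ‖`, where `Δ := A − sI − HHᵀ`"; here with the row-sum norm for `‖Δ‖`).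
[cite: Rump1999VerifiedLargeSystems, §4 (before Algorithm 4.1)] [cite: Rump1993, §2 I) p. 13–14] -/
theorem sigma_lower_of_symm_shifted_residual {A : Matrix n n ℝ} (hA : Aᵀ = A) (G : Matrix n k ℝ)
    {μ e : ℝ} (hE : ‖A - μ • (1 : Matrix n n ℝ) - G * Gᵀ‖ ≤ e) (v : n → ℝ) :
    (μ - e) * ‖toLp 2 v‖ ≤ ‖toLp 2 (A *ᵥ v)‖ := by
  have hrow : ∀ i, ∑ j, |(A - μ • (1 : Matrix n n ℝ) - G * Gᵀ) i j| ≤ e :=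
    fun i => (rowSum_le_linfty_opNorm _ i).trans hE
  have hq : (μ - e) * ‖toLp 2 v‖ ^ 2 ≤ ‖toLp 2 v‖ * ‖toLp 2 (A *ᵥ v)‖ :=
    (quadForm_lower_of_shifted_residual hA G hrow v).trans
      ((le_abs_self _).trans (abs_dotProduct_le _ _))
  rcases (norm_nonneg (toLp 2 v)).eq_or_lt with h0 | hpos
  · rw [← h0, mul_zero]; exact norm_nonneg _
  · have h1 : (μ - e) * ‖toLp 2 v‖ * ‖toLp 2 v‖ ≤ ‖toLp 2 (A *ᵥ v)‖ * ‖toLp 2 v‖ := by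
      calc (μ - e) * ‖toLp 2 v‖ * ‖toLp 2 v‖ = (μ - e) * ‖toLp 2 v‖ ^ 2 := by ring
        _ ≤ ‖toLp 2 v‖ * ‖toLp 2 (A *ᵥ v)‖ := hq
        _ = ‖toLp 2 (A *ᵥ v)‖ * ‖toLp 2 v‖ := mul_comm _ _
    exact le_of_mul_le_mul_right h1 hpos

/-- Algorithm 4.1 step 7 / (21): `A` symmetric, `‖A − μI − GGᵀ‖_∞ ≤ e < μ` ⟹ `A` is nonsingular (indeed
`σ_n(A) ≥ μ − e > 0`) and every approximate solution satisfies `‖A⁻¹b − x̃‖₂ ≤ ‖b − Ax̃‖₂ / (μ − e)`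
("If `s − δ > 0` then `A` is positive definite and `‖A⁻¹b − x̃‖ ≤ (s − δ)⁻¹‖Ax̃ − b‖`").
[cite: Rump1999VerifiedLargeSystems, §4 Algorithm 4.1 step 7] [cite: Rump1993, (21)] -/
theorem symm_solution_bound {A : Matrix n n ℝ} (hA : Aᵀ = A) (G : Matrix n k ℝ) {μ e : ℝ}
    (hE : ‖A - μ • (1 : Matrix n n ℝ) - G * Gᵀ‖ ≤ e) (hμ : e < μ) (b xt : n → ℝ) :
    IsUnit A.det ∧ ‖toLp 2 (A⁻¹ *ᵥ b - xt)‖ ≤ ‖toLp 2 (b - A *ᵥ xt)‖ / (μ - e) :=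
  have hlow := sigma_lower_of_symm_shifted_residual hA G hE
  ⟨isUnit_det_of_sigma_lower (sub_pos.mpr hμ) hlow,
    norm_toLp_inv_mulVec_sub_le (sub_pos.mpr hμ) hlow b xt⟩

end ShiftedCholesky

/-! ### Sanity checks (`n = 1`): the hypotheses are satisfiable and the bounds compute -/

/-- Theorem 2.2 with `Ã = A = I₁`, `s = 1`, `δ = 0`: `‖x̂ − x̃‖_∞ ≤ √1·‖b − x̃‖_∞/(1 − √1·0)`. -/
example (b xt : Fin 1 → ℝ) :
    ‖(1 : Matrix (Fin 1) (Fin 1) ℝ)⁻¹ *ᵥ b - xt‖ ≤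
      √(Fintype.card (Fin 1)) * ‖b - (1 : Matrix (Fin 1) (Fin 1) ℝ) *ᵥ xt‖ /
        (1 - √(Fintype.card (Fin 1)) * 0) :=
  (rump_2_2 (At := 1) (A := 1) (s := 1) (δ := 0) (fun v => by simp) (by simp) (by simp) b xt).2

/-- Theorem 2.1 with `L = I₁`, `G = 0`, `μ = 1`, `e = 0`: `√(1 − 0)·‖w‖₂ ≤ ‖I₁w‖₂`. -/
example (w : Fin 1 → ℝ) :
    √(1 - 0) * ‖toLp 2 w‖ ≤ ‖toLp 2 ((1 : Matrix (Fin 1) (Fin 1) ℝ) *ᵥ w)‖ :=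
  rump_2_1 (1 : Matrix (Fin 1) (Fin 1) ℝ) (0 : Matrix (Fin 1) (Fin 1) ℝ) (μ := 1) (e := 0)
    (by simp) zero_le_one w

end Literature.Analysis.Matrix.SingularValueVerification
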